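import Summits.QuantumAdvantage.QuantumAdvantage.Theses.CubicForrelation
import Literature.Computability.QuantumComplexity.ForrelationSignTransport

/-!
# Restrict/fold DESCENT for exactly forrelated pairs (support item stmt-QuantumAdvantage-14671)

Route `CubicForrelation`, item `SignedExactCubicForrelationInPrBPP` (= the negation of crux r3
`SignedExactCubicForrelationNotPrBPP`, `iff_not_notPrBPP`). Every existing refutation-direction line reads the
sign of an exact pair `Φ(a,b) = ±1` off a GLOBAL object (a half-dimensional M-subspace). This file proves the
LOCAL alternative, a certified dimension reduction by two (note `DESCENT.md` on the item, prover seat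
`pitem-14671-2`, 2026-08-16):

* `descent_step` — the DESCENT INVARIANT propagates. If `∑_{x ∈ E} (-1)^{b x} (-1)^{x·w} = C · (-1)^{a' w}`
  for all `w` (at the start `E = 𝔽₂ⁿ`, `a' = a`, `C = 2^{n/2} Φ(a,b)`: `base_invariant`), and `p₁, p₂` satisfy the
  second-derivative condition `D_{p₁} D_{p₂} a' ≡ 1`, then the same identity holds with `E` cut down to
  `E ∩ {x : x·p₁ = x·p₂ = 0}`, `C` halved, and `a'` replaced by its MAJORITY FOLD
  `w ↦ a' w ⊕ (D_{p₁}a'(w) ∧ D_{p₂}a'(w))` (the majority value of `a'` on the coset `w ⊕ ⟨p₁,p₂⟩`). No subspace,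
  dimension, degree or Maiorana–McFarland hypothesis: four characters and a 16-case Boolean identity
  (`signOf_sum_four_eq`).
* `base_invariant` — `Φ(a,b)² = 1` gives the invariant at level 0 (pointwise duality `two_pow_mul_W_eq`).
* `forrelation_eq_of_invariant` — READOUT at any level: `Φ(a,b) = (-1)^{a'(0)} · sgn ∑_{x∈E} (-1)^{b x}`; after
  `n/2` steps `E = {0}` and no sum is left, in a decider one stops when `|E| = 2^{n-2t}` is small.

Why it matters (prose; the complexity statement is NOT formalised here). For CUBIC `a` a pair `(p₁,p₂)` with
`D_{p₁}D_{p₂} a ≡ 1` whose fold is again cubic is found by linear algebra whenever the cubic form of `a` has a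
non-zero radical vector (`p₁` in the radical: `D_{p₁} a` is affine and non-constant), and the restricted side
stays cubic trivially; so every exact CUBIC pair descends, exact, cubic, same sign, until both cubic forms are
radical-free, where a good pair must come from a slice `T_a(u,·,·)` of rank `≤ 4` plus a linear partner system.
The item thus reduces to finding ONE good plane per level (hypothesis "DH" of the note) instead of an
M-subspace, and needs neither `FrameLock` nor crux r5. Numerics: 163/163 disguised instances, `n ≤ 96`.

References: [AaronsonAmbainis2018] §1.1.1 (`Φ`), §3.2 Prop. 6; [ODonnell2014] §1.4, §3.3 (characters,
restrictions); C. Carlet, Boolean Functions for Cryptography and Coding Theory (2021), §6.1 (restrictions of bent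
functions to affine subspaces and their duals — the codimension-2 case is the odd-weight / majority rule used here).
-/

set_option linter.dupNamespace false -- D-0017: single-problem summit ⇒ `QuantumAdvantage.QuantumAdvantage` by design

noncomputable section

namespace Summit.QuantumAdvantage.QuantumAdvantage.Theorems.SignedExactCubicForrelationInPrBPP.Descent

open Finset
open Literature.Computability.QuantumComplexity
open Literature.Computability.QuantumComplexity.BuzetChailloux (bxor zeroVec bxor_bxor_cancel_left bxor_zeroVec
  zeroVec_bxor twist_bxor_right twist_zeroVec_right signOf_sq)
open Literature.Computability.QuantumComplexity.Simon (twist_eq_one_or)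
open Literature.Computability.QuantumComplexity.DerivativeWalsh (W fsum two_pow_mul_W_eq fsum_signOf_eq
  fsum_signOf_sq_of_forrelation_sq sqrt_two_pow_three_mul)

variable {n : ℕ}

/-- The 16-case Boolean identity behind the majority fold: if four bits have odd parity then exactly one
or three of them are `1`, and `∑ (-1)^{vᵢ} = 2 · (-1)^{maj}` with `maj = v₁ ⊕ ((v₁⊕v₂)(v₁⊕v₃))`. [folklore] -/
theorem signOf_sum_four_eq (v₁ v₂ v₃ v₄ : Bool) (h : (v₁ ^^ v₂ ^^ v₃ ^^ v₄) = true) :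
    signOf v₁ + signOf v₂ + signOf v₃ + signOf v₄ = 2 * signOf (v₁ ^^ ((v₁ ^^ v₂) && (v₁ ^^ v₃))) := by
  revert h
  cases v₁ <;> cases v₂ <;> cases v₃ <;> cases v₄ <;> simp [signOf] <;> norm_num

/-- The indicator of `{x : (-1)^{x·p₁} = (-1)^{x·p₂} = 1}` as a character polynomial:
`[t₁ = 1 ∧ t₂ = 1] · s = ¼ (1 + t₁ + t₂ + t₁t₂) · s` for `t₁, t₂ ∈ {±1}`. [folklore] -/
theorem indicator_two_chars (x p₁ p₂ : Fin n → Bool) (s : ℝ) :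
    (if twist x p₁ = 1 ∧ twist x p₂ = 1 then s else 0) =
      (s + twist x p₁ * s + twist x p₂ * s + twist x p₁ * twist x p₂ * s) / 4 := by
  split_ifs with h
  · rw [h.1, h.2]; ring
  · rcases twist_eq_one_or x p₁ with h₁ | h₁ <;> rcases twist_eq_one_or x p₂ with h₂ | h₂
    · exact absurd ⟨h₁, h₂⟩ h
    all_goals rw [h₁, h₂]; ring

/-- **Descent step** (the invariant propagates; no hypothesis on `E`, degrees or dimensions). If
`∑_{x∈E} (-1)^{b x}(-1)^{x·w} = C·(-1)^{a' w}` for all `w` and `D_{p₁}D_{p₂} a' ≡ 1`, then for all `w`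
`∑_{x ∈ E, x·p₁ = x·p₂ = 0} (-1)^{b x}(-1)^{x·w} = (C/2)·(-1)^{fold(w)}` with the majority fold
`fold(w) = a' w ⊕ ((a' w ⊕ a'(w⊕p₁)) ∧ (a' w ⊕ a'(w⊕p₂)))`. Proof: expand the indicator into the four characters
`1, (-1)^{x·p₁}, (-1)^{x·p₂}, (-1)^{x·(p₁⊕p₂)}`, apply the invariant at `w, w⊕p₁, w⊕p₂, w⊕p₁⊕p₂`, and use
`signOf_sum_four_eq`. [folklore] -/
theorem descent_step (b a' : (Fin n → Bool) → Bool) (E : Finset (Fin n → Bool)) (C : ℝ)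
    (p₁ p₂ : Fin n → Bool)
    (hinv : ∀ w, ∑ x ∈ E, signOf (b x) * twist x w = C * signOf (a' w))
    (hD : ∀ w, (a' w ^^ a' (bxor w p₁) ^^ a' (bxor w p₂) ^^ a' (bxor w (bxor p₁ p₂))) = true)
    (w : Fin n → Bool) :
    ∑ x ∈ E.filter (fun x => twist x p₁ = 1 ∧ twist x p₂ = 1), signOf (b x) * twist x w =
      C / 2 * signOf (a' w ^^ ((a' w ^^ a' (bxor w p₁)) && (a' w ^^ a' (bxor w p₂)))) := by
  rw [sum_filter]
  have e1 : ∀ x ∈ E, (if twist x p₁ = 1 ∧ twist x p₂ = 1 then signOf (b x) * twist x w else 0) =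
      (signOf (b x) * twist x w + signOf (b x) * twist x (bxor w p₁) + signOf (b x) * twist x (bxor w p₂)
        + signOf (b x) * twist x (bxor w (bxor p₁ p₂))) / 4 := by
    intro x _
    rw [indicator_two_chars]
    simp only [twist_bxor_right]
    ring
  rw [sum_congr rfl e1, ← sum_div, sum_add_distrib, sum_add_distrib, sum_add_distrib, hinv, hinv, hinv, hinv]
  have h4 := signOf_sum_four_eq (a' w) (a' (bxor w p₁)) (a' (bxor w p₂)) (a' (bxor w (bxor p₁ p₂))) (hD w)
  have : C * signOf (a' w) + C * signOf (a' (bxor w p₁)) + C * signOf (a' (bxor w p₂)) +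
      C * signOf (a' (bxor w (bxor p₁ p₂))) =
      C * (signOf (a' w) + signOf (a' (bxor w p₁)) + signOf (a' (bxor w p₂)) +
        signOf (a' (bxor w (bxor p₁ p₂)))) := by ring
  rw [this, h4]
  ring

/-- **Base of the descent**: for an exact pair (`Φ(a,b)² = 1`) the level-0 invariant
`∑_x (-1)^{b x}(-1)^{x·w} = √(2ⁿ)·Φ(a,b)·(-1)^{a w}` — `b` is bent with dual sign pattern `Φ·(-1)^a`
(the pointwise Cauchy–Schwarz equality `two_pow_mul_W_eq`). [cite: AaronsonAmbainis2018, §1.1.1] -/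
theorem base_invariant (a b : (Fin n → Bool) → Bool) (h : forrelation a b ^ 2 = 1) (w : Fin n → Bool) :
    ∑ x ∈ (univ : Finset (Fin n → Bool)), signOf (b x) * twist x w =
      Real.sqrt ((2 : ℝ) ^ n) * forrelation a b * signOf (a w) := by
  have key := two_pow_mul_W_eq (fun x => signOf (a x)) (fun y => signOf (b y))
    (fun x => signOf_sq (a x)) (fun y => signOf_sq (b y)) (fsum_signOf_sq_of_forrelation_sq a b h) w
  rw [fsum_signOf_eq, sqrt_two_pow_three_mul] at key
  have h2 : (0 : ℝ) < (2 : ℝ) ^ n := by positivity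
  have hW : W (fun y => signOf (b y)) w = Real.sqrt ((2 : ℝ) ^ n) * forrelation a b * signOf (a w) := by
    apply mul_left_cancel₀ h2.ne'
    rw [key]; ring
  simpa [W] using hW

/-- **Readout** at any level of the descent: if `∑_{x∈E} (-1)^{b x}(-1)^{x·w} = K·Φ(a,b)·(-1)^{a' w}` for all
`w` with `K > 0` and `Φ(a,b) = ±1`, then `Φ(a,b) = (-1)^{a'(0)} · sgn(∑_{x∈E} (-1)^{b x})` (the sum is `± K ≠ 0`).
[folklore] -/
theorem forrelation_eq_of_invariant {a b a' : (Fin n → Bool) → Bool} {E : Finset (Fin n → Bool)} {K : ℝ}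
    (hK : 0 < K) (hΦ : forrelation a b = 1 ∨ forrelation a b = -1)
    (hinv : ∀ w, ∑ x ∈ E, signOf (b x) * twist x w = K * forrelation a b * signOf (a' w)) :
    forrelation a b = signOf (a' zeroVec) * (if 0 < ∑ x ∈ E, signOf (b x) then 1 else -1) := by
  have h0 := hinv zeroVec
  simp only [twist_zeroVec_right, mul_one] at h0
  rw [h0]
  rcases hΦ with h | h <;> cases ha : a' zeroVec <;> simp [h, signOf, hK, not_lt.2 hK.le]

/-- **One full step from an exact pair, packaged**: `Φ(a,b)² = 1` and `D_{p₁}D_{p₂} a ≡ 1` give the level-1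
invariant on `E₁ = {x : x·p₁ = x·p₂ = 0}` with constant `√(2ⁿ)/2 · Φ` and the folded `a`. Iterating
`descent_step` from here is bookkeeping for the consumer (each level halves the constant). [folklore] -/
theorem level_one_invariant (a b : (Fin n → Bool) → Bool) (h : forrelation a b ^ 2 = 1)
    (p₁ p₂ : Fin n → Bool)
    (hD : ∀ w, (a w ^^ a (bxor w p₁) ^^ a (bxor w p₂) ^^ a (bxor w (bxor p₁ p₂))) = true)
    (w : Fin n → Bool) :
    ∑ x ∈ (univ : Finset (Fin n → Bool)).filter (fun x => twist x p₁ = 1 ∧ twist x p₂ = 1),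
        signOf (b x) * twist x w =
      Real.sqrt ((2 : ℝ) ^ n) / 2 * forrelation a b *
        signOf (a w ^^ ((a w ^^ a (bxor w p₁)) && (a w ^^ a (bxor w p₂)))) := by
  have := descent_step b a univ (Real.sqrt ((2 : ℝ) ^ n) * forrelation a b) p₁ p₂
    (base_invariant a b h) hD w
  rw [this]; ring

/-- **Sign after one step** (the `n-2`-dimensional pair decides the original sign): under `Φ(a,b) = ±1` and
`D_{p₁}D_{p₂} a ≡ 1`, `Φ(a,b) = (-1)^{a(0) ⊕ (D_{p₁}a(0) ∧ D_{p₂}a(0))} · sgn ∑_{x·p₁ = x·p₂ = 0} (-1)^{b x}` — the restricted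
sum is over `2^{n-2}` points and is `± 2^{n/2 - 1}`. [folklore] -/
theorem forrelation_eq_after_one_step (a b : (Fin n → Bool) → Bool)
    (hΦ : forrelation a b = 1 ∨ forrelation a b = -1) (p₁ p₂ : Fin n → Bool)
    (hD : ∀ w, (a w ^^ a (bxor w p₁) ^^ a (bxor w p₂) ^^ a (bxor w (bxor p₁ p₂))) = true) :
    forrelation a b =
      signOf (a zeroVec ^^ ((a zeroVec ^^ a p₁) && (a zeroVec ^^ a p₂))) *
        (if 0 < ∑ x ∈ (univ : Finset (Fin n → Bool)).filter (fun x => twist x p₁ = 1 ∧ twist x p₂ = 1),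
            signOf (b x) then 1 else -1) := by
  have hsq : forrelation a b ^ 2 = 1 := by rcases hΦ with h | h <;> rw [h] <;> norm_num
  have hK : (0 : ℝ) < Real.sqrt ((2 : ℝ) ^ n) / 2 := by positivity
  have key := forrelation_eq_of_invariant (a := a) (b := b)
    (a' := fun w => a w ^^ ((a w ^^ a (bxor w p₁)) && (a w ^^ a (bxor w p₂))))
    (E := (univ : Finset (Fin n → Bool)).filter (fun x => twist x p₁ = 1 ∧ twist x p₂ = 1)) hK hΦ
    (fun w => level_one_invariant a b hsq p₁ p₂ hD w)
  simpa only [zeroVec_bxor] using key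

/-- **Regime A supplies the hypothesis of `descent_step`** (Boolean form of "p₁ in the radical of the cubic form"):
if the derivative `D_{p₁} a` is AFFINE (`D_{p₁}a(x⊕y) = D_{p₁}a(x) ⊕ D_{p₁}a(y) ⊕ D_{p₁}a(0)`) and `p₂` separates it
from its value at `0` (`D_{p₁}a(p₂) ≠ D_{p₁}a(0)` — possible as soon as `D_{p₁}a` is not constant, which bentness
guarantees), then `D_{p₁}D_{p₂} a ≡ 1`. For cubic `a` and `p₁` in the radical of its cubic form the derivative is affine,
and the fold `a ⊕ D_{p₁}a · D_{p₂}a` is again cubic (affine × quadratic) — the deterministic descent step of the note.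
[folklore] -/
theorem second_derivative_of_affine_derivative (a : (Fin n → Bool) → Bool) (p₁ p₂ : Fin n → Bool)
    (hadd : ∀ x y, (a (bxor (bxor x y) p₁) ^^ a (bxor x y)) =
      ((a (bxor x p₁) ^^ a x) ^^ ((a (bxor y p₁) ^^ a y) ^^ (a (bxor zeroVec p₁) ^^ a zeroVec))))
    (hne : (a (bxor p₂ p₁) ^^ a p₂) ≠ (a (bxor zeroVec p₁) ^^ a zeroVec)) (w : Fin n → Bool) :
    (a w ^^ a (bxor w p₁) ^^ a (bxor w p₂) ^^ a (bxor w (bxor p₁ p₂))) = true := by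
  have e : bxor w (bxor p₁ p₂) = bxor (bxor w p₂) p₁ := by
    funext i
    show (w i ^^ (p₁ i ^^ p₂ i)) = ((w i ^^ p₂ i) ^^ p₁ i)
    cases w i <;> cases p₁ i <;> cases p₂ i <;> rfl
  have h := hadd w p₂
  rw [e]
  revert h hne
  generalize a w = v₁
  generalize a (bxor w p₁) = v₂
  generalize a (bxor w p₂) = v₃
  generalize a (bxor (bxor w p₂) p₁) = v₄
  generalize a (bxor p₂ p₁) = u₁
  generalize a p₂ = u₂
  generalize a (bxor zeroVec p₁) = u₃
  generalize a zeroVec = u₄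
  cases v₁ <;> cases v₂ <;> cases v₃ <;> cases v₄ <;> cases u₁ <;> cases u₂ <;> cases u₃ <;> cases u₄ <;> decide

end Summit.QuantumAdvantage.QuantumAdvantage.Theorems.SignedExactCubicForrelationInPrBPP.Descent

end
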